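import Summits.QuantumFields.YangMills.Theorems.BalabanUVNodesRateCarriersOfRecord13On
import Summits.QuantumFields.YangMills.Theorems.BalabanUVNodesRateCarriersOfRecord13Co

/-!
# CORE EDITION of 5″ `BalabanUVNodesRateCarriersOfRecord13On` (p493794) — THE TUPLE-KEYED ∕ REGIME-RESTRICTED HOME `RRec₁₃CoOn 𝔯 Rg` (guard inside, bundles read AT θ) and the `stub_rates` junction §5 — KEYED ON THE bg-FREE PROVISO CORE `Stage13Params.Provisos₁₃Core` (the LAST re-key of this module).
#
# WHY THIS FILE EXISTS (plan g67 ★ CORE-YES, pub-ymgap INBOX l.17420; WORD-139 (1) l.16747; dag-lead WORDS-139 (3) l.16541; RR-2 g11 CORE l.17476; this seat's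
# DESIGN-INPUT-CORE l.17415).  The Stage-13 record's proviso structure is being re-pinned row by row toward print (v1.1 `Provisos₁₃` → v1.2 `Provisos₁₃Sep`
# (separated sequences + `PartCompat₁₃`, director-ym №136–№139) → v1.3 `Provisos₁₃SepMixed` (+ `Sect2.DataSmall7`, №142) → …); each edition re-mints the four cruxes and
# would re-key every storey typed `∀ θ (h : θ.Provisos₁₃<ed> F N), …`.  But the rate-side storeys are bg-BLIND and proviso-FIELD-blind: `h` enters only as a binder TYPE
# and inside `datumOfRecord₁₃<ed> F N θ h`; def-T's `Node00/Record13` v1.2 (p501191) carries the edition-free proviso CORE `Stage13Params.Provisos₁₃Core` (the nine non-bg rows)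
# with the maps `Provisos₁₃<ed>.toCore`, and — after director-ym №151∕№152 re-based the record at print's background U_k(V) (`UbgOfRecord₁₃Co`) — def-T's FILE 21
# `Node00/Record13Co` (p515035) carries the Core-KEYED tower ∕ datum ∕ record `towerOfRecord₁₃Co ∕ datumOfRecord₁₃Co ∕ IsRecordOfRecord₁₃CCo` with the `rfl` bridges
# `datumOfRecord₁₃<ed> F N θ h = datumOfRecord₁₃Co F N θ h.toCore` for every LATER edition (v1.4 `SepCo`, KEY-RULE-21 R4; v1.2's U_old `datumOfRecord₁₃Core` is superseded,
# def-T HOLD-21C).  So plan ruled (CORE-YES):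
# CONSUMER storeys key ONCE on `(hc : θ.Provisos₁₃Core F N)` ∕ `datumOfRecord₁₃Co` ∕ RR-2's bg-free datum key `Node00/Record13DatumKeyCo` (p515777; its `IsDatumOfRecord…` ∕ `IsRateKey…` classes,
# the record classes `IsRecordOfRecord…`, one-way bridges `.toCore` from every edition's keys), while the ITEM texts and the registered STUB texts stay
# edition-keyed and ONLY the K3 composer touches the item's proviso token — at an item tuple `(θ, h : θ.Provisos₁₃<ed> F 2)` it applies these storeys at `hc := h.toCore`,
# datum by `rfl`.  This file is the (T-RATE) pen's CORE twin of its own ‴ module under the token map `Provisos₁₃ ↦ Provisos₁₃Core` · `datumOfRecord₁₃ ↦ datumOfRecord₁₃Core` ·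
# `(Is|is)DatumOfRecord₁₃C… ↦ …₁₃CCore…` · `(Is|is)RecordOfRecord₁₃C… ↦ …₁₃CCore…` · `IsRateKey₁₃ ↦ IsRateKey₁₃Core` and, for THIS seat's names, `Core` inserted after `₁₃`
# in the stage-KEYED stems only (`RateReading₁₃`, `rateCarriersOfRecord₁₃`, `RRec₁₃(On)`, `rRec₁₃…`, `readingOfRecord₁₃`, `…datumKey₁₃…`, `n22_tupleReadingOfRecord(On)…`).
# EVERYTHING θ-LEVEL IS UNCHANGED AND NOT RE-DECLARED: `Stage13Params`, `u3OfRecord₁₃ θ u k` and its faces, the θ-form closers `n22At_u3OfRecord₁₃_…` of the ‴ modules carry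
# no proviso and are IMPORTED BY NAME (this module imports its ‴ original) — here: none of the original's decls is θ-only.  Statements = the ‴ statements under the map, proofs = the ‴ proofs verbatim.  The ⁗
# `…13Sep…` twin of this module (rev-18∕19 homes) stays in the tree as the ⁗ asides' context.  NOMINAL STRENGTH: Core-keyed storeys quantify over more tuples (no bg row) —
# harmless: every hypothesis here is θ-generic under `θ.Admissible` and the slot data, none reads `bg`.
#
# ITEM IDS: crux names ∕ item ids quoted in the ‴ header below (K0‴–K3‴ = stmt-QuantumFields-19909…19912) are the rev-16∕17 ones, ASIDES now; this file is filed
# `--supports stmt-QuantumFields-20292` (the K3 item of record at filing time, per dag-lead's KEY MAP) as a HELPER — count-neutral, no stub closed, N22 NOT discharged, no inhabitant of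
# any key claimed (K0 OPEN at every edition).
#
# ‴ HEADER OF RECORD FOLLOWS (token-mapped; its decl lists are this file's, the θ-only names above excepted):
#
# THE TUPLE-KEYED AND REGIME-RESTRICTED RATE-CARRIER PREDICATES AT STAGE 13 — `YMDAG.UVSplit.RRec₁₃CoOn 𝔯 Rg : RateRecordPred N`: at `(F, D, g₀, os)` it pins the
# bundles of EVERY admissible Stage-13 tuple `θ` with provisos IN THE REGIME `Rg F θ` whose datum of record IS `D`, read AT `θ` ITSELF (not at the canonical parameter);
# the (T-RATE) twin of (T-SPINE)'s Stage-13 regime home (dag-n20-d, `…SpineCarriersOfRecord13{,Keyed}`), so that a K3‴ composer can read the K4 rate stubs WITH THE GUARD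
# INSIDE (`∀ θ hP, Rg F θ → θ.Admissible F N → …`) and at the SAME tuple as the spine bundle; plus the K3‴ skeleton's `stub_rates13` shape FROM THE HOME (§5)

Track A of `YM-PLAN.md` (cell `pub-ymgap`, HUMAN RULING D-0062), R134 seat `pub-ymgap-dag-n22-e` ((T-RATE) pen), gen 5, module 5″ = the `12 ↦ 13` re-key of this seat's module 5
`…RateCarriersOfRecord12On.lean` (p468431) over layer B at ₁₃ (`…RateCarriersOfRecord13`, module 1″) — director-ym LINE №125 «RECORD 13» ∕ №133 (route rev 16 ∕ 17: K3‴
`SpineGivenEndpointR13` = stmt-QuantumFields-19912 typed over `Node00.Stage13Params F 2`, binder prefix «`(θ.ZtUnity F 2 ∧ θ.SlotsNondegenerate₁₃ F 2) → θ.Admissible F 2 →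
…`»), dag-lead KEY TABLE WORDS-133 ∕ 134, node00-def-RR-2 g6 READ-5 NOTE-9 (pub-ymgap INBOX l.15981: «plan g66's registered `stub_rates13 : ∃ rr : RateReading 2, KeyedRates rr
∧ KeyedWindow rr` (`D66-REV16/K3Skeleton13.lean`) is EXACTLY the shape §5 states UNFOLDED — keep §5 so the K3‴ lead closes `stub_rates13` against a tree face»).  WHY.  Layer B
at ₁₃ keys `RRec₁₃Co 𝔯` by RR-2's CANONICAL datum key (`h.params := Classical.choose h`); the rev-16 items guard the TUPLE, and a guard on θ does NOT reach `h.params` (RR-2,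
`Node00/Record13DatumKey` §4: the C key carries `Provisos₁₃Core ∧ Admissible` only; regime-consuming readings quantify over `IsDatumOfRecord₁₃CCoOn F N Rg`).  This module supplies, on
the rate side, the TUPLE-keyed predicate restricted to an arbitrary regime `Rg`, its one-application faces, the comparison with the canonical home, the instances at print's
partition of unity `θ.ZtUnity` and at THE GUARD OF RECORD `Node00.unityNondeg₁₃ N` (= `θ.ZtUnity F N ∧ θ.SlotsNondegenerate₁₃ F N`, RR-2 §7), and the `stub_rates13` junction.
Definition lane (ONE `def`); every theorem is kernel bookkeeping; 0 `sorry`; COUNT-NEUTRAL; `--supports` K3‴ (stmt-QuantumFields-19912).  Restate-immune (no Theses import: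
`RateReading 2`, `KeyedRates`, `KeyedWindow` of the skeleton appear UNFOLDED, `N`-generic); nothing landed is edited.

WHAT THIS MODULE PROVES ([bookkeeping]; the Stage-12 list under `12 ↦ 13` + the guard-of-record instance).
* §1 `RRec₁₃CoOn 𝔯 Rg` · `rRec₁₃CoOn_iff` (`Iff.rfl`) · `rRec₁₃CoOn_self` · `RRec₁₃CoOn.stage13 ∕ .isDatumOfRecord₁₃CCo ∕ .isDatumOfRecord₁₃CCoOn ∕ .window ∕ .moduli ∕ .gamma_pos ∕ .other_level` ·
  `rRec₁₃CoOn_mono` (a larger regime pins more) · `rRec₁₃Co_le_rRec₁₃CoOn_true` (the canonical home's bundles are among the tuple-keyed ones at the trivial regime) ·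
  `rRec₁₃CoOn_of_regime_params` (… and among the `Rg`-restricted ones whenever the canonical parameters lie in `Rg`).
* §2 THE GUARDED θ-FORMS: `rateStub_rRec₁₃CoOn_iff` (master) · `s_N14 ∕ s_N15 ∕ s_N16 ∕ s_N17 ∕ s_N18 ∕ s_N22 ∕ s_D4_rRec₁₃CoOn_iff` — each K4 stub at `RRec₁₃CoOn 𝔯 Rg` IS
  «for every family, every admissible θ with provisos IN `Rg`, every `g₀, os, k`: the node's estimate at `rateCarriersOfRecord₁₃Co 𝔯 F θ hP g₀ os k` (on the datum `datumOfRecord₁₃Co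
  F N θ hP` for N17 ∕ (D4))» · `rateInputsAll_rRec₁₃CoOn_iff`.
* §3 TRANSFERS: `k4_rRec₁₃CoOn_anti` (antitone in the regime) · `k4_rRec₁₃Co_of_rRec₁₃CoOn_true` (stubs at the tuple-keyed home ⟹ stubs at the canonical home `RRec₁₃Co 𝔯`) ·
  `s_R00x_rRec₁₃CoOn_of_regime` (existence at every record of a record class whose records come with a θ IN THE REGIME) · `s_R00x_rRec₁₃CoOn_true` · `s_R00x_rRec₁₃CoOn_unityNondeg`
  (existence at RR-2's CN record class `IsRecordOfRecord₁₃CCoN` for the guard-of-record home).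
* §4 the UNITY ∕ GUARD-OF-RECORD instances: `s_N22_rRec₁₃CoOn_ztUnity_iff` · `s_N22_rRec₁₃CoOn_unityNondeg_iff` (N22's stub at `RRec₁₃CoOn 𝔯 (Node00.unityNondeg₁₃ N)` IS the rev-16
  binder prefix «`∀ F θ hP, (θ.ZtUnity F N ∧ θ.SlotsNondegenerate₁₃ F N) → θ.Admissible F N → ∀ g₀ os k, N22At …`») · `rateStub_rRec₁₃CoOn_unityNondeg_iff` (master, any stub).
* §5 THE K3‴ SKELETON's `stub_rates13` SHAPE FROM THE HOME: `rateCarriersOfRecord₁₃Co_u3_γ` (`KeyedWindow` by `rfl`), `ratesAt_of_k4_rRec₁₃CoOn` (the six stubs at the tuple-keyed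
  home ⇒ `RatesAt` at every tuple-level bundle on its datum), `exists_keyedRates_window_of_k4_rRec₁₃CoOn_true(_glueN17)` (⇒ `∃ rr, KeyedRates rr ∧ KeyedWindow rr` UNFOLDED,
  witness = the level-selected home reading `fun F θ hP g₀ os => rateCarriersOfRecord₁₃Co 𝔯 F θ hP g₀ os (ksel F θ g₀ os)`) — the junction only; the six node estimates stay the
  stubs' content.

HONEST FRAMING.  PINS ONLY; the reading `𝔯` is residual; nothing of Bałaban's is asserted; NE1′ ∕ … ∕ NE9 NOT PRINTED for d = 4 and NOT PROVED; no inhabitant of any key claimed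
(K0‴ `Record13Inhabited`, stmt-QuantumFields-19909, OPEN); no node discharged; counts UNMOVED (typed 28∕28 · discharged 5∕27, A 5∕28); one finite four-torus programme at fixed
`ε` — NOT ℝ⁴, NOT infinite volume, NOT OS, NOT a mass gap, NOT Clay.  No decl below carries a cite tag.
-/

noncomputable section

namespace YMDAG.UVSplit

open Literature.MathematicalPhysics.QuantumFieldTheory.Balaban1983to89
open Literature.MathematicalPhysics.QuantumFieldTheory.Balaban1983to89.T4Continuum
open Literature.MathematicalPhysics.QuantumFieldTheory.Balaban1983to89.T4OutputRate (Window)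
open Node00 (Stage13Params datumOfRecord₁₃Co IsRecordOfRecord₁₃CCo IsDatumOfRecord₁₃CCo)

variable {N : ℕ} [NeZero N]

/-! ## §1 The regime-restricted, tuple-keyed rate-carrier predicate -/

/-- **THE `Rg`-RESTRICTED, TUPLE-KEYED RATE-CARRIER PREDICATE OF RECORD, STAGE 13** (PINS ONLY): at `(F, D, g₀, os)` it pins the bundles of every run length `k` read from `𝔯`
AT every admissible Stage-13 tuple `θ` with provisos `hP` IN THE REGIME `Rg F θ` whose datum of record IS `D`. -/
def RRec₁₃CoOn (𝔯 : RateReading₁₃Co N) (Rg : (F : T4Family) → Stage13Params F N → Prop) : RateRecordPred N :=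
  fun F D g₀ os R => ∃ (θ : Stage13Params F N) (hP : θ.Provisos₁₃Core F N), Rg F θ ∧ θ.Admissible F N ∧ D = datumOfRecord₁₃Co F N θ hP ∧
    ∃ k : ℕ, R = rateCarriersOfRecord₁₃Co 𝔯 F θ hP g₀ os k

variable (𝔯 : RateReading₁₃Co N) (Rg : (F : T4Family) → Stage13Params F N → Prop)

/-- Unfolding (`Iff.rfl`). -/
theorem rRec₁₃CoOn_iff {F : T4Family} (D : Datum F N) (g₀ : ℕ → ℝ) (os : List (ULoop F)) (R : RateCarriers N) :
    RRec₁₃CoOn 𝔯 Rg F D g₀ os R ↔ ∃ (θ : Stage13Params F N) (hP : θ.Provisos₁₃Core F N), Rg F θ ∧ θ.Admissible F N ∧ D = datumOfRecord₁₃Co F N θ hP ∧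
      ∃ k : ℕ, R = rateCarriersOfRecord₁₃Co 𝔯 F θ hP g₀ os k :=
  Iff.rfl

/-- **IN THE REGIME, EVERY RUN LENGTH OF THE READING AT `θ` IS PINNED AT `θ`'s OWN DATUM.** -/
theorem rRec₁₃CoOn_self {F : T4Family} (θ : Stage13Params F N) (hP : θ.Provisos₁₃Core F N) (hRg : Rg F θ) (hθ : θ.Admissible F N) (g₀ : ℕ → ℝ)
    (os : List (ULoop F)) (k : ℕ) : RRec₁₃CoOn 𝔯 Rg F (datumOfRecord₁₃Co F N θ hP) g₀ os (rateCarriersOfRecord₁₃Co 𝔯 F θ hP g₀ os k) :=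
  ⟨θ, hP, hRg, hθ, rfl, k, rfl⟩

namespace RRec₁₃CoOn

variable {𝔯 Rg} {F : T4Family} {D : Datum F N} {g₀ : ℕ → ℝ} {os : List (ULoop F)} {R : RateCarriers N}

/-- **TYPED OVER STAGE 13, IN THE REGIME**: a pinned bundle comes with an admissible tuple with provisos in `Rg` realising the datum, at which it is read, and whose window IS the
bundle's radius. -/
theorem stage13 (hR : RRec₁₃CoOn 𝔯 Rg F D g₀ os R) :
    ∃ (θ : Stage13Params F N) (hP : θ.Provisos₁₃Core F N) (k : ℕ), Rg F θ ∧ θ.Admissible F N ∧ D = datumOfRecord₁₃Co F N θ hP ∧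
      R = rateCarriersOfRecord₁₃Co 𝔯 F θ hP g₀ os k ∧ R.u3.γ = θ.γ := by
  obtain ⟨θ, hP, hRg, hθ, hD, k, rfl⟩ := hR
  exact ⟨θ, hP, k, hRg, hθ, hD, rfl, rfl⟩

/-- The datum of a pinned bundle is a Stage-13 datum of record (the C key forgets the regime). -/
theorem isDatumOfRecord₁₃CCo (hR : RRec₁₃CoOn 𝔯 Rg F D g₀ os R) : IsDatumOfRecord₁₃CCo F N D := by
  obtain ⟨θ, hP, -, hθ, hD, -⟩ := hR
  rw [hD]
  exact Node00.isDatumOfRecord₁₃CCo_datumOfRecord₁₃Co F N θ hP hθ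

/-- … and a datum of record IN THE REGIME (RR-2's regime key `Node00.IsDatumOfRecord₁₃CCoOn F N Rg`, `Node00/Record13DatumKey` §4). -/
theorem isDatumOfRecord₁₃CCoOn (hR : RRec₁₃CoOn 𝔯 Rg F D g₀ os R) : Node00.IsDatumOfRecord₁₃CCoOn F N Rg D := by
  obtain ⟨θ, hP, hRg, hθ, hD, -⟩ := hR
  rw [hD]
  exact Node00.isDatumOfRecord₁₃CCoOn_datumOfRecord₁₃Co F N Rg θ hP hRg hθ

/-- The bundle's window IS `Window R.u3.γ`. -/
theorem window (hR : RRec₁₃CoOn 𝔯 Rg F D g₀ os R) : R.u3.W = Window R.u3.γ := by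
  obtain ⟨θ, hP, -, -, -, k, rfl⟩ := hR
  rfl

/-- The bundle's moduli ARE `C₉·ω^{k−i}`. -/
theorem moduli (hR : RRec₁₃CoOn 𝔯 Rg F D g₀ os R) : R.u3.Λ = fun a i => R.u3.C₉ * R.u3.ω ^ (a - i) := by
  obtain ⟨θ, hP, -, -, -, k, rfl⟩ := hR
  rfl

/-- The bundle's radius is positive. -/
theorem gamma_pos (hR : RRec₁₃CoOn 𝔯 Rg F D g₀ os R) : 0 < R.u3.γ := by
  obtain ⟨θ, hP, -, hθ, -, k, rfl⟩ := hR
  exact hθ.toStage9.gamma_pos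

/-- **THE TOWER KEY, IN THE REGIME**: every other run length of the reading AT THE SAME TUPLE is pinned at the same datum. -/
theorem other_level (hR : RRec₁₃CoOn 𝔯 Rg F D g₀ os R) (k' : ℕ) :
    ∃ (θ : Stage13Params F N) (hP : θ.Provisos₁₃Core F N) (k : ℕ), R = rateCarriersOfRecord₁₃Co 𝔯 F θ hP g₀ os k ∧
      RRec₁₃CoOn 𝔯 Rg F D g₀ os (rateCarriersOfRecord₁₃Co 𝔯 F θ hP g₀ os k') := by
  obtain ⟨θ, hP, hRg, hθ, hD, k, rfl⟩ := hR
  exact ⟨θ, hP, k, rfl, θ, hP, hRg, hθ, hD, k', rfl⟩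

end RRec₁₃CoOn

/-- **MONOTONE IN THE REGIME**: a larger regime pins more bundles. -/
theorem rRec₁₃CoOn_mono {Rg Rg' : (F : T4Family) → Stage13Params F N → Prop} (h : ∀ F θ, Rg F θ → Rg' F θ) {F : T4Family} {D : Datum F N} {g₀ : ℕ → ℝ}
    {os : List (ULoop F)} {R : RateCarriers N} (hR : RRec₁₃CoOn 𝔯 Rg F D g₀ os R) : RRec₁₃CoOn 𝔯 Rg' F D g₀ os R := by
  obtain ⟨θ, hP, hRg, hθ, hD, k, hk⟩ := hR
  exact ⟨θ, hP, h F θ hRg, hθ, hD, k, hk⟩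

/-- **THE CANONICAL HOME PINS A SUB-CLASS OF THE TUPLE-KEYED HOME AT THE TRIVIAL REGIME**: the canonical parameter `h.params` is one admissible tuple with provisos realising `D`. -/
theorem rRec₁₃Co_le_rRec₁₃CoOn_true {F : T4Family} {D : Datum F N} {g₀ : ℕ → ℝ} {os : List (ULoop F)} {R : RateCarriers N} (hR : RRec₁₃Co 𝔯 F D g₀ os R) :
    RRec₁₃CoOn 𝔯 (fun _ _ => True) F D g₀ os R := by
  obtain ⟨h, k, rfl⟩ := hR
  exact ⟨h.params, h.provisos, trivial, h.admissible, h.eq_datumOfRecord₁₃Co, k, rfl⟩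

/-- … and of the `Rg`-restricted home whenever the canonical parameters of the data of record lie IN `Rg`. -/
theorem rRec₁₃CoOn_of_regime_params (hreg : ∀ (F : T4Family) (D : Datum F N) (h : IsDatumOfRecord₁₃CCo F N D), Rg F h.params) {F : T4Family} {D : Datum F N}
    {g₀ : ℕ → ℝ} {os : List (ULoop F)} {R : RateCarriers N} (hR : RRec₁₃Co 𝔯 F D g₀ os R) : RRec₁₃CoOn 𝔯 Rg F D g₀ os R := by
  obtain ⟨h, k, rfl⟩ := hR
  exact ⟨h.params, h.provisos, hreg F D h, h.admissible, h.eq_datumOfRecord₁₃Co, k, rfl⟩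

/-! ## §2 The GUARDED θ-forms of the K4 stubs at `RRec₁₃CoOn 𝔯 Rg` -/

/-- **THE MASTER FACE**: a stub «for every pinned bundle, `P D R`» at `RRec₁₃CoOn 𝔯 Rg` IS «for every family, every admissible θ with provisos IN THE REGIME, every `g₀, os, k`:
`P (datumOfRecord₁₃Co F N θ hP) (rateCarriersOfRecord₁₃Co 𝔯 F θ hP g₀ os k)`» — the guard sits INSIDE, and the bundle is read AT θ. -/
theorem rateStub_rRec₁₃CoOn_iff (P : ∀ {F : T4Family}, Datum F N → RateCarriers N → Prop) :
    (∀ (F : T4Family) (D : Datum F N) (g₀ : ℕ → ℝ) (os : List (ULoop F)) (R : RateCarriers N), RRec₁₃CoOn 𝔯 Rg F D g₀ os R → P D R) ↔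
      ∀ (F : T4Family) (θ : Stage13Params F N) (hP : θ.Provisos₁₃Core F N), Rg F θ → θ.Admissible F N →
        ∀ (g₀ : ℕ → ℝ) (os : List (ULoop F)) (k : ℕ), P (datumOfRecord₁₃Co F N θ hP) (rateCarriersOfRecord₁₃Co 𝔯 F θ hP g₀ os k) := by
  constructor
  · intro hS F θ hP hRg hθ g₀ os k
    exact hS F _ g₀ os _ (rRec₁₃CoOn_self 𝔯 Rg θ hP hRg hθ g₀ os k)
  · rintro hS F D g₀ os R ⟨θ, hP, hRg, hθ, rfl, k, rfl⟩
    exact hS F θ hP hRg hθ g₀ os k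

/-- **N14 at the regime-restricted home** (guarded θ-form). -/
theorem s_N14_rRec₁₃CoOn_iff : S_N14 (RRec₁₃CoOn 𝔯 Rg) ↔ ∀ (F : T4Family) (θ : Stage13Params F N) (hP : θ.Provisos₁₃Core F N), Rg F θ → θ.Admissible F N →
    ∀ (g₀ : ℕ → ℝ) (os : List (ULoop F)), N14At (𝔯.ne1 F θ hP g₀ os) :=
  (rateStub_rRec₁₃CoOn_iff 𝔯 Rg fun _ R => N14At R.ne1).trans
    ⟨fun h F θ hP hRg hθ g₀ os => h F θ hP hRg hθ g₀ os 0, fun h F θ hP hRg hθ g₀ os _ => h F θ hP hRg hθ g₀ os⟩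

/-- **N15 at the regime-restricted home** (guarded θ-form). -/
theorem s_N15_rRec₁₃CoOn_iff : S_N15 (RRec₁₃CoOn 𝔯 Rg) ↔ ∀ (F : T4Family) (θ : Stage13Params F N) (hP : θ.Provisos₁₃Core F N), Rg F θ → θ.Admissible F N →
    ∀ (g₀ : ℕ → ℝ) (os : List (ULoop F)) (k : ℕ), N15At (ne2OfRecord₁₁ ((𝔯.lit F θ hP g₀ os).ne2 k)) :=
  rateStub_rRec₁₃CoOn_iff 𝔯 Rg fun _ R => N15At R.ne2

/-- **N16 at the regime-restricted home** (guarded θ-form). -/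
theorem s_N16_rRec₁₃CoOn_iff : S_N16 (RRec₁₃CoOn 𝔯 Rg) ↔ ∀ (F : T4Family) (θ : Stage13Params F N) (hP : θ.Provisos₁₃Core F N), Rg F θ → θ.Admissible F N →
    ∀ (g₀ : ℕ → ℝ) (os : List (ULoop F)) (k : ℕ), N16At (ne3OfRecord₁₁ F ((𝔯.lit F θ hP g₀ os).ne3 k)) :=
  rateStub_rRec₁₃CoOn_iff 𝔯 Rg fun _ R => N16At R.ne3

/-- **N17 at the regime-restricted home** (guarded θ-form, ON THE DATUM `datumOfRecord₁₃Co F N θ hP`). -/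
theorem s_N17_rRec₁₃CoOn_iff : S_N17 (RRec₁₃CoOn 𝔯 Rg) ↔ ∀ (F : T4Family) (θ : Stage13Params F N) (hP : θ.Provisos₁₃Core F N), Rg F θ → θ.Admissible F N →
    ∀ (g₀ : ℕ → ℝ) (os : List (ULoop F)) (k : ℕ), N17At (datumOfRecord₁₃Co F N θ hP) (u3OfRecord₁₃ θ (𝔯.lit F θ hP g₀ os).u3 k) :=
  rateStub_rRec₁₃CoOn_iff 𝔯 Rg fun D R => N17At D R.u3

/-- **N18 at the regime-restricted home** (guarded θ-form). -/
theorem s_N18_rRec₁₃CoOn_iff : S_N18 (RRec₁₃CoOn 𝔯 Rg) ↔ ∀ (F : T4Family) (θ : Stage13Params F N) (hP : θ.Provisos₁₃Core F N), Rg F θ → θ.Admissible F N →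
    ∀ (g₀ : ℕ → ℝ) (os : List (ULoop F)) (k : ℕ), N18At (u3OfRecord₁₃ θ (𝔯.lit F θ hP g₀ os).u3 k) :=
  rateStub_rRec₁₃CoOn_iff 𝔯 Rg fun _ R => N18At R.u3

/-- **N22 at the regime-restricted home** (guarded θ-form). -/
theorem s_N22_rRec₁₃CoOn_iff : S_N22 (RRec₁₃CoOn 𝔯 Rg) ↔ ∀ (F : T4Family) (θ : Stage13Params F N) (hP : θ.Provisos₁₃Core F N), Rg F θ → θ.Admissible F N →
    ∀ (g₀ : ℕ → ℝ) (os : List (ULoop F)) (k : ℕ), N22At (u3OfRecord₁₃ θ (𝔯.lit F θ hP g₀ os).u3 k) :=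
  rateStub_rRec₁₃CoOn_iff 𝔯 Rg fun _ R => N22At R.u3

/-- **(D4) at the regime-restricted home** (guarded θ-form, on the datum). -/
theorem s_D4_rRec₁₃CoOn_iff : S_D4 (RRec₁₃CoOn 𝔯 Rg) ↔ ∀ (F : T4Family) (θ : Stage13Params F N) (hP : θ.Provisos₁₃Core F N), Rg F θ → θ.Admissible F N →
    ∀ (g₀ : ℕ → ℝ) (os : List (ULoop F)) (k : ℕ), ReadOutAt (datumOfRecord₁₃Co F N θ hP) (u3OfRecord₁₃ θ (𝔯.lit F θ hP g₀ os).u3 k) :=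
  rateStub_rRec₁₃CoOn_iff 𝔯 Rg fun D R => ReadOutAt D R.u3

/-- **K4's ∀-HOOK at the regime-restricted home**: at `(F, D, g₀, os)`, «the six in-edges at every run length of the reading AT EVERY admissible tuple with provisos in `Rg`
realising `D`». -/
theorem rateInputsAll_rRec₁₃CoOn_iff {F : T4Family} (D : Datum F N) (g₀ : ℕ → ℝ) (os : List (ULoop F)) :
    RateInputsAll (RRec₁₃CoOn 𝔯 Rg) F D g₀ os ↔ ∀ (θ : Stage13Params F N) (hP : θ.Provisos₁₃Core F N), Rg F θ → θ.Admissible F N →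
      D = datumOfRecord₁₃Co F N θ hP → ∀ k : ℕ, RatesAt D (rateCarriersOfRecord₁₃Co 𝔯 F θ hP g₀ os k) := by
  constructor
  · intro hall θ hP hRg hθ hD k
    exact hall _ ⟨θ, hP, hRg, hθ, hD, k, rfl⟩
  · rintro hall R ⟨θ, hP, hRg, hθ, hD, k, rfl⟩
    exact hall θ hP hRg hθ hD k

/-! ## §3 Transfers: antitone in the regime; to the canonical home; existence at a regime-restricted record class -/

/-- **THE SEVEN K4 STUBS ARE ANTITONE IN THE REGIME**: proved over a larger regime, they hold over every smaller one. -/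
theorem k4_rRec₁₃CoOn_anti {Rg Rg' : (F : T4Family) → Stage13Params F N → Prop} (h : ∀ F θ, Rg F θ → Rg' F θ) :
    (S_N14 (RRec₁₃CoOn 𝔯 Rg') → S_N14 (RRec₁₃CoOn 𝔯 Rg)) ∧ (S_N15 (RRec₁₃CoOn 𝔯 Rg') → S_N15 (RRec₁₃CoOn 𝔯 Rg)) ∧
      (S_N16 (RRec₁₃CoOn 𝔯 Rg') → S_N16 (RRec₁₃CoOn 𝔯 Rg)) ∧ (S_N17 (RRec₁₃CoOn 𝔯 Rg') → S_N17 (RRec₁₃CoOn 𝔯 Rg)) ∧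
      (S_N18 (RRec₁₃CoOn 𝔯 Rg') → S_N18 (RRec₁₃CoOn 𝔯 Rg)) ∧ (S_N22 (RRec₁₃CoOn 𝔯 Rg') → S_N22 (RRec₁₃CoOn 𝔯 Rg)) ∧
      (S_D4 (RRec₁₃CoOn 𝔯 Rg') → S_D4 (RRec₁₃CoOn 𝔯 Rg)) :=
  ⟨fun hS F D g₀ os R hR => hS F D g₀ os R (rRec₁₃CoOn_mono 𝔯 h hR), fun hS F D g₀ os R hR => hS F D g₀ os R (rRec₁₃CoOn_mono 𝔯 h hR),
    fun hS F D g₀ os R hR => hS F D g₀ os R (rRec₁₃CoOn_mono 𝔯 h hR), fun hS F D g₀ os R hR => hS F D g₀ os R (rRec₁₃CoOn_mono 𝔯 h hR),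
    fun hS F D g₀ os R hR => hS F D g₀ os R (rRec₁₃CoOn_mono 𝔯 h hR), fun hS F D g₀ os R hR => hS F D g₀ os R (rRec₁₃CoOn_mono 𝔯 h hR),
    fun hS F D g₀ os R hR => hS F D g₀ os R (rRec₁₃CoOn_mono 𝔯 h hR)⟩

/-- **STUBS AT THE TUPLE-KEYED HOME GIVE STUBS AT THE CANONICAL HOME** `RRec₁₃Co 𝔯` (layer B at ₁₃, `…RateCarriersOfRecord13`) — `rRec₁₃Co_le_rRec₁₃CoOn_true`. -/
theorem k4_rRec₁₃Co_of_rRec₁₃CoOn_true :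
    (S_N14 (RRec₁₃CoOn 𝔯 fun _ _ => True) → S_N14 (RRec₁₃Co 𝔯)) ∧ (S_N15 (RRec₁₃CoOn 𝔯 fun _ _ => True) → S_N15 (RRec₁₃Co 𝔯)) ∧
      (S_N16 (RRec₁₃CoOn 𝔯 fun _ _ => True) → S_N16 (RRec₁₃Co 𝔯)) ∧ (S_N17 (RRec₁₃CoOn 𝔯 fun _ _ => True) → S_N17 (RRec₁₃Co 𝔯)) ∧
      (S_N18 (RRec₁₃CoOn 𝔯 fun _ _ => True) → S_N18 (RRec₁₃Co 𝔯)) ∧ (S_N22 (RRec₁₃CoOn 𝔯 fun _ _ => True) → S_N22 (RRec₁₃Co 𝔯)) ∧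
      (S_D4 (RRec₁₃CoOn 𝔯 fun _ _ => True) → S_D4 (RRec₁₃Co 𝔯)) :=
  ⟨fun hS F D g₀ os R hR => hS F D g₀ os R (rRec₁₃Co_le_rRec₁₃CoOn_true 𝔯 hR), fun hS F D g₀ os R hR => hS F D g₀ os R (rRec₁₃Co_le_rRec₁₃CoOn_true 𝔯 hR),
    fun hS F D g₀ os R hR => hS F D g₀ os R (rRec₁₃Co_le_rRec₁₃CoOn_true 𝔯 hR), fun hS F D g₀ os R hR => hS F D g₀ os R (rRec₁₃Co_le_rRec₁₃CoOn_true 𝔯 hR),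
    fun hS F D g₀ os R hR => hS F D g₀ os R (rRec₁₃Co_le_rRec₁₃CoOn_true 𝔯 hR), fun hS F D g₀ os R hR => hS F D g₀ os R (rRec₁₃Co_le_rRec₁₃CoOn_true 𝔯 hR),
    fun hS F D g₀ os R hR => hS F D g₀ os R (rRec₁₃Co_le_rRec₁₃CoOn_true 𝔯 hR)⟩

/-- **`S_R00x` AT THE REGIME-RESTRICTED HOME FOR A REGIME-RESTRICTED RECORD CLASS**: if every record `(D, w)` of `Rec` comes with an admissible tuple with provisos IN THE
REGIME realising `D` (e.g. `Rec` = the `Rg`-guarded Stage-13 record class a θ-keyed K3‴ composer quantifies over), the rate carriers of record EXIST under the pins for every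
tuned run and loop string — witness run length `0` at that tuple.  Existence is free (objects residual). -/
theorem s_R00x_rRec₁₃CoOn_of_regime {Rec : RecordPred N}
    (hRec : ∀ (F : T4Family) (D : Datum F N) (w : DagBinding.WorldP), Rec F D w →
      ∃ (θ : Stage13Params F N) (hP : θ.Provisos₁₃Core F N), Rg F θ ∧ θ.Admissible F N ∧ D = datumOfRecord₁₃Co F N θ hP) :
    S_R00x Rec (RRec₁₃CoOn 𝔯 Rg) := by
  intro F D w hR _ _
  obtain ⟨θ, hP, hRg, hθ, hD⟩ := hRec F D w hR
  exact T4ContinuumYM4Torus.ForSmallCouplings.of_forall fun g₀ os => ⟨_, θ, hP, hRg, hθ, hD, 0, rfl⟩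

/-- **… in particular at RR-2's REGIME-RESTRICTED RECORD CLASS `Node00.IsRecordOfRecord₁₃CCoOn F N Rg`** (the class a guarded ∀-item composer quantifies over,
`Node00/Record13DatumKey` §5; `IsRecordOfRecord₁₃CCoOn.exists_regime_tuple`). -/
theorem s_R00x_rRec₁₃CoOn_recordOn : S_R00x (fun F D w => Node00.IsRecordOfRecord₁₃CCoOn F N Rg D w) (RRec₁₃CoOn 𝔯 Rg) :=
  s_R00x_rRec₁₃CoOn_of_regime 𝔯 Rg fun _ _ _ hR => hR.exists_regime_tuple

/-- **… at THE GUARD OF RECORD**: existence at RR-2's CN record class `Node00.IsRecordOfRecord₁₃CCoN F N` («partition of unity ∧ non-degenerate present slots», §7) for the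
guard-of-record home `RRec₁₃CoOn 𝔯 (Node00.unityNondeg₁₃ N)`. -/
theorem s_R00x_rRec₁₃CoOn_unityNondeg :
    S_R00x (fun F D w => Node00.IsRecordOfRecord₁₃CCoN F N D w) (RRec₁₃CoOn 𝔯 (Node00.unityNondeg₁₃ N)) :=
  s_R00x_rRec₁₃CoOn_recordOn 𝔯 _

/-- **… in particular at the UNRESTRICTED Stage-13 record class and the trivial regime** (`Node00.exists_provisos_of_isRecordOfRecord₁₃CCo`). -/
theorem s_R00x_rRec₁₃CoOn_true : S_R00x (fun F D w => IsRecordOfRecord₁₃CCo F N D w) (RRec₁₃CoOn 𝔯 fun _ _ => True) :=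
  s_R00x_rRec₁₃CoOn_of_regime 𝔯 _ fun F D w hR => by
    obtain ⟨θ, hP, hθ, hD⟩ := Node00.exists_provisos_of_isRecordOfRecord₁₃CCo hR
    exact ⟨θ, hP, trivial, hθ, hD⟩

/-! ## §4 The unity and guard-of-record instances are one-liners (no further `def`; regimes are parameters) -/

/-- **EXAMPLE OF RECORD — THE UNITY REGIME** (director-ym LINE №99: print's partition of unity `θ.ZtUnity`): N22's stub at the unity-restricted tuple-keyed home IS the guarded
θ-form «for every admissible θ with provisos AND `θ.ZtUnity F N`, every `g₀, os, k`: `N22At` at the bundle read at θ». -/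
theorem s_N22_rRec₁₃CoOn_ztUnity_iff :
    S_N22 (RRec₁₃CoOn 𝔯 fun F θ => θ.ZtUnity F N) ↔ ∀ (F : T4Family) (θ : Stage13Params F N) (hP : θ.Provisos₁₃Core F N), θ.ZtUnity F N → θ.Admissible F N →
      ∀ (g₀ : ℕ → ℝ) (os : List (ULoop F)) (k : ℕ), N22At (u3OfRecord₁₃ θ (𝔯.lit F θ hP g₀ os).u3 k) :=
  s_N22_rRec₁₃CoOn_iff 𝔯 _

/-- **THE GUARD OF RECORD — master θ-form**: a K4 stub `∀ F D g₀ os R, RRec₁₃CoOn 𝔯 (Node00.unityNondeg₁₃ N) F D g₀ os R → P D R` IS rev 16's binder prefix «for every family,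
every Stage-13 tuple `θ` with provisos, `(θ.ZtUnity F N ∧ θ.SlotsNondegenerate₁₃ F N) → θ.Admissible F N →` every `g₀, os, k`: `P` at `θ`'s datum and the bundle read at `θ`»
(`Node00.unityNondeg₁₃` unfolds by `Iff.rfl`). -/
theorem rateStub_rRec₁₃CoOn_unityNondeg_iff (P : {F : T4Family} → Datum F N → RateCarriers N → Prop) :
    (∀ (F : T4Family) (D : Datum F N) (g₀ : ℕ → ℝ) (os : List (ULoop F)) (R : RateCarriers N), RRec₁₃CoOn 𝔯 (Node00.unityNondeg₁₃ N) F D g₀ os R → P D R) ↔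
      ∀ (F : T4Family) (θ : Stage13Params F N) (hP : θ.Provisos₁₃Core F N), (θ.ZtUnity F N ∧ θ.SlotsNondegenerate₁₃ F N) → θ.Admissible F N →
        ∀ (g₀ : ℕ → ℝ) (os : List (ULoop F)) (k : ℕ), P (datumOfRecord₁₃Co F N θ hP) (rateCarriersOfRecord₁₃Co 𝔯 F θ hP g₀ os k) :=
  rateStub_rRec₁₃CoOn_iff 𝔯 _ P

/-- **N22 AT THE GUARD-OF-RECORD HOME** `RRec₁₃CoOn 𝔯 (Node00.unityNondeg₁₃ N)`: N22's stub there IS the guarded θ-form in rev 16's binder shape «`(θ.ZtUnity F N ∧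
θ.SlotsNondegenerate₁₃ F N) → θ.Admissible F N → ∀ g₀ os k, N22At (u3OfRecord₁₃ θ … k)`». -/
theorem s_N22_rRec₁₃CoOn_unityNondeg_iff :
    S_N22 (RRec₁₃CoOn 𝔯 (Node00.unityNondeg₁₃ N)) ↔ ∀ (F : T4Family) (θ : Stage13Params F N) (hP : θ.Provisos₁₃Core F N),
      (θ.ZtUnity F N ∧ θ.SlotsNondegenerate₁₃ F N) → θ.Admissible F N →
        ∀ (g₀ : ℕ → ℝ) (os : List (ULoop F)) (k : ℕ), N22At (u3OfRecord₁₃ θ (𝔯.lit F θ hP g₀ os).u3 k) :=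
  s_N22_rRec₁₃CoOn_iff 𝔯 _

/-! ## §5 The K3‴ skeleton's `stub_rates13` shape from the tuple-keyed home (plan g66 `D66-REV16/K3Skeleton13.lean`, stubs of stmt-QuantumFields-19912: a SINGLE-BUNDLE tuple reading
`rr : (F θ hP g₀ os) ↦ RateCarriers N` with `KeyedRates rr` — the six rates at every admissible tuple ON ITS DATUM — and `KeyedWindow rr` — `(rr …).u3.γ = θ.γ`) -/

/-- The tuple-level bundle's window radius IS `θ.γ` (`rfl`) — `KeyedWindow` of every level-selected reading `fun F θ hP g₀ os => rateCarriersOfRecord₁₃Co 𝔯 F θ hP g₀ os (ksel …)`. -/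
theorem rateCarriersOfRecord₁₃Co_u3_γ (F : T4Family) (θ : Stage13Params F N) (hP : θ.Provisos₁₃Core F N) (g₀ : ℕ → ℝ) (os : List (ULoop F)) (k : ℕ) :
    (rateCarriersOfRecord₁₃Co 𝔯 F θ hP g₀ os k).u3.γ = θ.γ := rfl

/-- **THE SIX K4 STUBS AT THE TUPLE-KEYED HOME GIVE THE SIX RATES AT EVERY TUPLE-LEVEL BUNDLE ON ITS DATUM** (regime `Rg`; `RatesAt` = N14 ∧ N15 ∧ N16 ∧ N17 ∧ N18 ∧ N22). -/
theorem ratesAt_of_k4_rRec₁₃CoOn (h14 : S_N14 (RRec₁₃CoOn 𝔯 Rg)) (h15 : S_N15 (RRec₁₃CoOn 𝔯 Rg)) (h16 : S_N16 (RRec₁₃CoOn 𝔯 Rg)) (h17 : S_N17 (RRec₁₃CoOn 𝔯 Rg))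
    (h18 : S_N18 (RRec₁₃CoOn 𝔯 Rg)) (h22 : S_N22 (RRec₁₃CoOn 𝔯 Rg)) (F : T4Family) (θ : Stage13Params F N) (hP : θ.Provisos₁₃Core F N) (hRg : Rg F θ)
    (hθ : θ.Admissible F N) (g₀ : ℕ → ℝ) (os : List (ULoop F)) (k : ℕ) :
    RatesAt (datumOfRecord₁₃Co F N θ hP) (rateCarriersOfRecord₁₃Co 𝔯 F θ hP g₀ os k) :=
  have hR := rRec₁₃CoOn_self 𝔯 Rg θ hP hRg hθ g₀ os k
  ⟨h14 F _ g₀ os _ hR, h15 F _ g₀ os _ hR, h16 F _ g₀ os _ hR, h17 F _ g₀ os _ hR, h18 F _ g₀ os _ hR, h22 F _ g₀ os _ hR⟩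

/-- **`stub_rates13`'s BODY FROM THE HOME** (N-generic, `KeyedRates`∕`KeyedWindow` unfolded): the six K4 stubs at the tuple-keyed home at the trivial regime give, for ANY
run-length selector `ksel`, a single-bundle tuple reading `rr` carrying the six rates at every admissible tuple on its datum and whose U3 window IS the record's — witness
`rr F θ hP g₀ os := rateCarriersOfRecord₁₃Co 𝔯 F θ hP g₀ os (ksel F θ g₀ os)`.  The K3‴ line lead supplies the six stubs (the nodes' estimates at a NAMED `𝔯`); this is the
junction, not an estimate. -/
theorem exists_keyedRates_window_of_k4_rRec₁₃CoOn_true (ksel : (F : T4Family) → Stage13Params F N → (ℕ → ℝ) → List (ULoop F) → ℕ)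
    (h14 : S_N14 (RRec₁₃CoOn 𝔯 fun _ _ => True)) (h15 : S_N15 (RRec₁₃CoOn 𝔯 fun _ _ => True)) (h16 : S_N16 (RRec₁₃CoOn 𝔯 fun _ _ => True))
    (h17 : S_N17 (RRec₁₃CoOn 𝔯 fun _ _ => True)) (h18 : S_N18 (RRec₁₃CoOn 𝔯 fun _ _ => True)) (h22 : S_N22 (RRec₁₃CoOn 𝔯 fun _ _ => True)) :
    ∃ rr : (F : T4Family) → (θ : Stage13Params F N) → θ.Provisos₁₃Core F N → (ℕ → ℝ) → List (ULoop F) → RateCarriers N,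
      (∀ (F : T4Family) (θ : Stage13Params F N) (hP : θ.Provisos₁₃Core F N), θ.Admissible F N → ∀ (g₀ : ℕ → ℝ) (os : List (ULoop F)),
          RatesAt (datumOfRecord₁₃Co F N θ hP) (rr F θ hP g₀ os)) ∧
        ∀ (F : T4Family) (θ : Stage13Params F N) (hP : θ.Provisos₁₃Core F N) (g₀ : ℕ → ℝ) (os : List (ULoop F)), (rr F θ hP g₀ os).u3.γ = θ.γ :=
  ⟨fun F θ hP g₀ os => rateCarriersOfRecord₁₃Co 𝔯 F θ hP g₀ os (ksel F θ g₀ os),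
    fun F θ hP hθ g₀ os => ratesAt_of_k4_rRec₁₃CoOn 𝔯 _ h14 h15 h16 h17 h18 h22 F θ hP trivial hθ g₀ os _, fun _ _ _ _ _ => rfl⟩

/-- **… WITH N17 GLUED** (`N17_of_U3edge`: (D4) ∧ N18 ∧ N22 ⇒ N17 at any home): five stubs + (D4) suffice. -/
theorem exists_keyedRates_window_of_k4_rRec₁₃CoOn_true_glueN17 (ksel : (F : T4Family) → Stage13Params F N → (ℕ → ℝ) → List (ULoop F) → ℕ)
    (h14 : S_N14 (RRec₁₃CoOn 𝔯 fun _ _ => True)) (h15 : S_N15 (RRec₁₃CoOn 𝔯 fun _ _ => True)) (h16 : S_N16 (RRec₁₃CoOn 𝔯 fun _ _ => True))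
    (h18 : S_N18 (RRec₁₃CoOn 𝔯 fun _ _ => True)) (h22 : S_N22 (RRec₁₃CoOn 𝔯 fun _ _ => True)) (hD4 : S_D4 (RRec₁₃CoOn 𝔯 fun _ _ => True)) :
    ∃ rr : (F : T4Family) → (θ : Stage13Params F N) → θ.Provisos₁₃Core F N → (ℕ → ℝ) → List (ULoop F) → RateCarriers N,
      (∀ (F : T4Family) (θ : Stage13Params F N) (hP : θ.Provisos₁₃Core F N), θ.Admissible F N → ∀ (g₀ : ℕ → ℝ) (os : List (ULoop F)),
          RatesAt (datumOfRecord₁₃Co F N θ hP) (rr F θ hP g₀ os)) ∧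
        ∀ (F : T4Family) (θ : Stage13Params F N) (hP : θ.Provisos₁₃Core F N) (g₀ : ℕ → ℝ) (os : List (ULoop F)), (rr F θ hP g₀ os).u3.γ = θ.γ :=
  exists_keyedRates_window_of_k4_rRec₁₃CoOn_true 𝔯 ksel h14 h15 h16 (N17_of_U3edge _ hD4 h18 h22) h18 h22

end YMDAG.UVSplit

end
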